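import Mathlib.RingTheory.Artinian.Module
import Mathlib.RingTheory.AlgebraicIndependent.TranscendenceBasis
import Mathlib.Algebra.Module.LinearMap.Rat
import Literature.NumberTheory.Transcendental.KirbyWeakSchanuel
import Literature.NumberTheory.Transcendental.KirbyRelativeSchanuel
import Literature.NumberTheory.Transcendental.KirbyEDerivations
import Literature.NumberTheory.Transcendental.AxSchanuel
import Literature.NumberTheory.Transcendental.EclPregeometry
import HarnessLib

/-!
# Kirby's weak Schanuel property: reduction to Ax's theorem and `cl ⊆ ecl`

Proofs file (sibling of `KirbyWeakSchanuel.lean`) for the named fact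
`Literature.NumberTheory.Transcendental.kirby_weakSchanuel_ecl_empty` (Kirby, Bull. Lond. Math. Soc. 42 (2010), Thm. 1.2
at `F = ℂ_exp`, `C = ecl ∅`). Following the printed proof (ibid. p. 11: "theorem 1.2 follows
from corollary 5.2"; Cor. 5.2 is Ax's theorem [Ax 1971, Thm. 3 = ibid. Thm. 5.1] applied to
`Δ = EDer(F/C)`), we prove here, sorry-free:

* `Literature.NumberTheory.Transcendental.trdeg_adjoin_le_of_subset` — base change: for subfields `L ⊆ E` of `K` and `S ⊆ K`,
  `trdeg_E E[S] ≤ trdeg_L L(S)` (a transcendence basis of `E[S]/E` inside `S` stays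
  algebraically independent over `L`).
* `Literature.NumberTheory.Transcendental.exists_finite_eDer_family` — the reduction of Kirby's *set* `Δ = EDer(K/C)` to a *finite*
  family of E-derivations detecting the same `ℚ`-linear dependences of `x̄` modulo constants
  (descending chain condition in `ℚⁿ`), so that the tree's finite-family rendering
  `Literature.NumberTheory.Transcendental.ax_schanuel` of Ax's theorem applies.
* `Literature.NumberTheory.Transcendental.le_relTrdeg_of_dcl_subset` — **Kirby 2010, Cor. 5.2** (with the pregeometry dimension
  dropped): if `C` is `cl`-closed and `x̄` is `ℚ`-linearly independent modulo `⟨C⟩_ℚ` then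
  `n ≤ td(x̄, exp x̄ / C)`, *from* `ax_schanuel`; and `Literature.NumberTheory.Transcendental.relLinDim_le_relTrdeg_of_dcl_subset`,
  the same for arbitrary `x̄` (`ldim_ℚ(x̄/C) ≤ td(x̄, exp x̄/C)`).
* `Literature.NumberTheory.Transcendental.Kirby2010_weakSchanuel_of` — the fact `Kirby2010_weakSchanuel K` of `EclPregeometry.lean`
  (Thm. 1.2, `δ(x̄/C) ≥ 0` for `ecl`-closed `C`) from `ax_schanuel` and `Kirby2010_dcl_subset_ecl K`
  (Prop. 7.1).
* `Literature.NumberTheory.Transcendental.kirby_weakSchanuel_ecl_empty_of` — the target fact from the same two named facts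
  (and `Literature.NumberTheory.Transcendental.kirby_relative_schanuel_complex_of`: the verbatim duplicate fact of
  `KirbyRelativeSchanuel.lean`).

What remains for an unconditional `kirby_weakSchanuel_ecl_empty_holds`: discharging
`Literature.NumberTheory.Transcendental.ax_schanuel` (Ax 1971, Thm. 3) and `Literature.Kirby2010_dcl_subset_ecl ℂ`
(Kirby 2010, Prop. 7.1).

## References

* J. Kirby, *Exponential algebraicity in exponential fields*, Bull. Lond. Math. Soc. 42 (2010),
  879–890, arXiv:0810.4285: Thm. 1.2, Thm. 5.1, Cor. 5.2, Prop. 7.1, p. 11.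
* J. Ax, *On Schanuel's conjectures*, Ann. of Math. 93 (1971), 252–268, Thm. 3.
-/

noncomputable section

open Cardinal

namespace Literature.NumberTheory.Transcendental

/-! ### Transcendence degree under change of base field -/

section BaseChange

variable {F K : Type*} [Field F] [Field K] [Algebra F K]

/-- Base change for transcendence degrees of generated subalgebras: if `L ⊆ E` are a subfield
and a subring of the field `K` and `S ⊆ K`, then `trdeg_E E[S] ≤ trdeg_L L(S)`. Proof: `E[S]`
has a transcendence basis `u ⊆ S` over `E` (Mathlib's `exists_isTranscendenceBasis_between`);
`u` is algebraically independent over `E`, hence over `L ⊆ E`, inside `L(S)`. [folklore] -/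
theorem trdeg_adjoin_le_of_subset (E : Subring K) (L : IntermediateField F K)
    (hLE : (L : Set K) ⊆ E) (S : Set K) :
    Algebra.trdeg E (Algebra.adjoin E S) ≤ Algebra.trdeg L (IntermediateField.adjoin L S) := by
  classical
  set A : Subalgebra E K := Algebra.adjoin E S with hA
  set t : Set A := ((↑) : A → K) ⁻¹' S with ht
  have hinjA : Function.Injective (algebraMap E A) := by
    intro a b h
    have h' := congrArg ((↑) : A → K) h
    simp only [Subalgebra.coe_algebraMap] at h'
    exact Subtype.val_injective h'
  have htop : Algebra.adjoin E t = ⊤ := by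
    apply Subalgebra.map_injective (f := A.val) Subtype.val_injective
    rw [Algebra.map_top, Subalgebra.range_val, ← Algebra.adjoin_image, Subalgebra.coe_val,
      Set.image_preimage_eq_inter_range]
    have hr : Set.range ((↑) : A → K) = (A : Set K) := Subtype.range_coe
    rw [hr, Set.inter_eq_left.mpr Algebra.subset_adjoin]
  haveI : Algebra.IsAlgebraic (Algebra.adjoin E t) A := by
    rw [htop]
    exact ⟨fun a => isAlgebraic_algebraMap (⟨a, Algebra.mem_top⟩ : (⊤ : Subalgebra E A))⟩
  obtain ⟨u, -, hut, hu⟩ := exists_isTranscendenceBasis_between (R := E) ∅ t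
    (Set.empty_subset _) ((algebraicIndependent_empty_iff E A).mpr hinjA)
  have hcard : #u = Algebra.trdeg E A := hu.cardinalMk_eq_trdeg
  -- the basis as a family in `K`, algebraically independent over `E`, then over `L`
  have h1 : AlgebraicIndependent E (A.val ∘ ((↑) : u → A)) := hu.1.map' Subtype.val_injective
  set f : L →+* E := (algebraMap L K).codRestrict E fun a => hLE a.2 with hf
  have hfinj : Function.Injective f := by
    intro a b h
    have h' := congrArg ((↑) : E → K) h
    exact Subtype.val_injective (by simpa [hf] using h')
  have h2 : AlgebraicIndependent L (A.val ∘ ((↑) : u → A)) := by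
    refine AlgebraicIndependent.of_ringHom_of_comp_eq f (RingHom.id K) ?_ hfinj ?_
    · simpa using h1
    · ext a
      rfl
  -- and inside `L(S)`
  set B := IntermediateField.adjoin L S with hB
  have hmem : ∀ i : u, (A.val ∘ ((↑) : u → A)) i ∈ B := fun i =>
    IntermediateField.subset_adjoin L S (hut i.2)
  have h3 : AlgebraicIndependent L (fun i : u => (⟨_, hmem i⟩ : B)) :=
    AlgebraicIndependent.of_comp B.val h2
  calc Algebra.trdeg E A = #u := hcard.symm
    _ ≤ Algebra.trdeg L B := h3.cardinalMk_le_trdeg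

end BaseChange

/-! ### From Kirby's set of E-derivations to a finite family -/

section FiniteFamily

variable {K : Type*} [Field K]

/-- A derivation of a field kills (the image of) the rationals. [folklore] -/
theorem derivation_map_ratCast (D : Derivation ℤ K K) (q : ℚ) : D (q : K) = 0 := by
  have hden : ((q.den : K))⁻¹ ∈ Transcendental.constantSubring (fun _ : Unit => D) :=
    Transcendental.inv_mem_constantSubring fun _ => D.map_natCast q.den
  rw [Rat.cast_def, div_eq_mul_inv, Derivation.leibniz, hden (), D.map_intCast, smul_zero,
    smul_zero, add_zero]

variable [CharZero K] [Literature.ModelTheory.ExponentialFields.ExponentialRing K]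

/-- **From Kirby's `Δ = EDer(K/C)` to a finite family.** If `C` is `cl`-closed
(`dcl C ⊆ C`) and `x̄` is `ℚ`-linearly independent modulo `⟨C⟩_ℚ`, then finitely many
E-derivations `D₁, …, D_m` over `C` already witness that `x̄` is `ℚ`-linearly independent
modulo their common constants (`IsQLinearIndependentMod D x`): the subspaces of `ℚⁿ` of
dependences modulo the constants of finite subfamilies satisfy the descending chain condition,
and a minimal one records dependences modulo `⋂_{∂ ∈ Δ} ker ∂ = dcl C = C`, which are trivial.
(Kirby 2010, proof of Cor. 5.2, uses the whole set `Δ`; Ax's theorem is vendored for finite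
families in `AxSchanuel.lean`.) [cite: Kirby2010, Cor. 5.2 (proof)] -/
theorem exists_finite_eDer_family {C : Set K} (hC : dcl C ⊆ C) {n : ℕ} {x : Fin n → K}
    (hx : LinearIndependent ℚ ((Submodule.span ℚ C).mkQ ∘ x)) :
    ∃ (m : ℕ) (D : Fin m → Derivation ℤ K K),
      (∀ j, D j ∈ eDer K C) ∧ Transcendental.IsQLinearIndependentMod D x := by
  classical
  -- dependence spaces of finite families: `v ∈ W p` iff every `p.2 j` kills `∑ vᵢ xᵢ`
  let W : (Σ m : ℕ, Fin m → Derivation ℤ K K) → Submodule ℚ (Fin n → ℚ) := fun p =>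
    ⨅ j, LinearMap.ker ((p.2 j).toLinearMap.toAddMonoidHom.toRatLinearMap ∘ₗ
      Fintype.linearCombination ℚ x)
  have hmemW : ∀ (p : Σ m : ℕ, Fin m → Derivation ℤ K K) (v : Fin n → ℚ),
      v ∈ W p ↔ ∀ j, p.2 j (∑ i, v i • x i) = 0 := fun p v => by
    simp only [W, Submodule.mem_iInf, LinearMap.mem_ker, LinearMap.comp_apply,
      Fintype.linearCombination_apply, AddMonoidHom.coe_toRatLinearMap,
      LinearMap.toAddMonoidHom_coe, Derivation.coeFn_coe]
  -- the achievable dependence spaces, and a minimal one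
  set Wset : Set (Submodule ℚ (Fin n → ℚ)) :=
    Set.range fun p : (Σ m : ℕ, Fin m → eDer K C) => W ⟨p.1, fun j => (p.2 j).1⟩ with hWset
  have hWne : Wset.Nonempty :=
    ⟨_, Set.mem_range_self (⟨0, Fin.elim0⟩ : Σ m : ℕ, Fin m → eDer K C)⟩
  obtain ⟨M', ⟨⟨m, D⟩, rfl⟩, hmin⟩ := IsArtinian.set_has_minimal Wset hWne
  refine ⟨m, fun j => (D j).1, fun j => (D j).2, ?_⟩
  -- minimality: every E-derivation over `C` kills the combinations recorded by `D`
  have hall : ∀ v ∈ W ⟨m, fun j => (D j).1⟩, ∀ D' ∈ eDer K C, D' (∑ i, v i • x i) = 0 := by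
    intro v hv D' hD'
    have hle : W ⟨m + 1, fun j => (Fin.snoc (α := fun _ => eDer K C) D ⟨D', hD'⟩ j).1⟩ ≤
        W ⟨m, fun j => (D j).1⟩ := by
      intro w hw
      rw [hmemW] at hw ⊢
      intro j
      simpa only [Fin.snoc_castSucc] using hw (Fin.castSucc j)
    have heq : W ⟨m + 1, fun j => (Fin.snoc (α := fun _ => eDer K C) D ⟨D', hD'⟩ j).1⟩ =
        W ⟨m, fun j => (D j).1⟩ :=
      eq_of_le_of_not_lt hle
        (hmin _ (Set.mem_range_self
          (⟨m + 1, Fin.snoc (α := fun _ => eDer K C) D ⟨D', hD'⟩⟩ : Σ m : ℕ, Fin m → eDer K C)))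
    rw [← heq, hmemW] at hv
    simpa only [Fin.snoc_last] using hv (Fin.last m)
  -- conclusion
  intro q hq
  set v : Fin n → ℚ := fun i => (q i : ℚ) with hv
  have hsum : (∑ i, v i • x i) = ∑ i, (q i : K) * x i :=
    Finset.sum_congr rfl fun i _ => by rw [hv, Rat.smul_def, Rat.cast_intCast]
  have hvmem : v ∈ W ⟨m, fun j => (D j).1⟩ := by
    rw [hmemW]
    intro j
    rw [hsum]
    exact hq j
  have hdcl : (∑ i, v i • x i) ∈ dcl C := fun D' hD' => hall v hvmem D' hD'
  have hspan : (∑ i, v i • x i) ∈ Submodule.span ℚ C := Submodule.subset_span (hC hdcl)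
  have hzero : (∑ i, v i • ((Submodule.span ℚ C).mkQ ∘ x) i) = 0 := by
    have h1 : (Submodule.span ℚ C).mkQ (∑ i, v i • x i) = 0 := by
      rw [Submodule.mkQ_apply, Submodule.Quotient.mk_eq_zero]
      exact hspan
    simpa only [map_sum, map_smul, Function.comp_apply] using h1
  have hv0 := Fintype.linearIndependent_iff.mp hx v hzero
  funext i
  have := hv0 i
  simp only [hv, Int.cast_eq_zero] at this
  exact this

end FiniteFamily

/-! ### Kirby 2010, Cor. 5.2 from Ax's theorem -/

section Cor52

variable {K : Type} [Field K] [CharZero K] [Literature.ModelTheory.ExponentialFields.ExponentialRing K]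

/-- **Kirby 2010, Cor. 5.2** (weak Schanuel property over `cl`-closed sets, with the
non-negative pregeometry-dimension term dropped), for `ℚ`-linearly independent tuples, *from*
Ax's theorem (`Literature.NumberTheory.Transcendental.ax_schanuel`, Ax 1971 Thm. 3): if `dcl C ⊆ C` and
`x : Fin n → K` is `ℚ`-linearly independent modulo `⟨C⟩_ℚ`, then `n ≤ td(x̄, exp x̄ / C)`.
Proof as printed: `Δ = EDer(K/C)`, `yᵢ = exp xᵢ`, constants `= C`; here `Δ` is first cut down
to a finite family (`exists_finite_eDer_family`) and the base of the transcendence degree is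
moved from the constants of that family down to `ℚ(C)` (`trdeg_adjoin_le_of_subset`).
[cite: Kirby2010, Cor. 5.2] -/
theorem le_relTrdeg_of_dcl_subset (hAx : Transcendental.ax_schanuel) {C : Set K}
    (hC : dcl C ⊆ C) {n : ℕ} {x : Fin n → K}
    (hx : LinearIndependent ℚ ((Submodule.span ℚ C).mkQ ∘ x)) :
    (n : Cardinal) ≤ relTrdeg C x := by
  obtain ⟨m, D, hD, hind⟩ := exists_finite_eDer_family hC hx
  have h := hAx K m n D x (Literature.ModelTheory.ExponentialFields.ExponentialRing.exp ∘ x)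
    (fun i => (Literature.ModelTheory.ExponentialFields.ExponentialRing.isUnit_exp (x i)).ne_zero) (fun j i => (hD j).1 (x i)) hind
  have hn : (n : Cardinal) ≤ ((n + (Matrix.of fun i j => D j (x i)).rank : ℕ) : Cardinal) := by
    exact_mod_cast Nat.le_add_right _ _
  refine hn.trans (h.trans ?_)
  -- the constants of `D` as an intermediate field over `ℚ` containing `C`, hence `ℚ(C)`
  let E : IntermediateField ℚ K :=
    ({ Transcendental.constantSubring D with
        inv_mem' := fun _ ha => Transcendental.inv_mem_constantSubring ha } : Subfield K)
      |>.toIntermediateField fun q j => by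
        rw [Algebra.algebraMap_eq_smul_one, Rat.smul_one_eq_cast]
        exact derivation_map_ratCast (D j) q
  have hE : (E : Set K) = Transcendental.constantSubring D := rfl
  have hCsub : C ⊆ (E : Set K) := fun c hc =>
    show c ∈ Transcendental.constantSubring D from fun j => (hD j).2 c hc
  have hLE : ((IntermediateField.adjoin ℚ C : IntermediateField ℚ K) : Set K) ⊆
      Transcendental.constantSubring D := by
    rw [← hE]
    exact IntermediateField.adjoin_le_iff.mpr hCsub
  exact trdeg_adjoin_le_of_subset (Transcendental.constantSubring D) (IntermediateField.adjoin ℚ C)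
    hLE (Set.range x ∪ Set.range (Literature.ModelTheory.ExponentialFields.ExponentialRing.exp ∘ x))

/-- `td(x̄, exp x̄ / C)` is monotone under passing to a sub-tuple `x̄ ∘ a`. [folklore] -/
theorem relTrdeg_comp_le {n : ℕ} (C : Set K) (x : Fin n → K) {ι : Type} [Fintype ι]
    (e : ι ≃ Fin (Fintype.card ι)) (a : ι → Fin n) :
    relTrdeg C ((x ∘ a) ∘ e.symm) ≤ relTrdeg C x := by
  unfold relTrdeg
  set L := IntermediateField.adjoin ℚ C
  have hsub : Set.range ((x ∘ a) ∘ e.symm) ∪ Set.range (Literature.ModelTheory.ExponentialFields.ExponentialRing.exp ∘ ((x ∘ a) ∘ e.symm)) ⊆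
      Set.range x ∪ Set.range (Literature.ModelTheory.ExponentialFields.ExponentialRing.exp ∘ x) := by
    apply Set.union_subset_union
    · rintro _ ⟨i, rfl⟩; exact ⟨a (e.symm i), rfl⟩
    · rintro _ ⟨i, rfl⟩; exact ⟨a (e.symm i), rfl⟩
  exact trdeg_le_of_injective
    (IntermediateField.inclusion (IntermediateField.adjoin.mono L _ _ hsub))
    (IntermediateField.inclusion_injective _)

/-- **Kirby 2010, Cor. 5.2 / Thm. 1.2** in the form `ldim_ℚ(x̄/C) ≤ td(x̄, exp x̄ / C)` for a
`cl`-closed `C` and an arbitrary tuple `x̄`, from Ax's theorem: reduce to a maximal sub-tuple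
that is `ℚ`-linearly independent modulo `⟨C⟩_ℚ`. [cite: Kirby2010, Cor. 5.2] -/
theorem relLinDim_le_relTrdeg_of_dcl_subset (hAx : Transcendental.ax_schanuel) {C : Set K}
    (hC : dcl C ⊆ C) {n : ℕ} (x : Fin n → K) :
    (relLinDim C x : Cardinal) ≤ relTrdeg C x := by
  classical
  obtain ⟨κ, a, ha, hspan, hli⟩ := exists_linearIndependent' ℚ ((Submodule.span ℚ C).mkQ ∘ x)
  haveI : Fintype κ := Fintype.ofInjective a ha
  set e := Fintype.equivFin κ
  have hli' : LinearIndependent ℚ ((Submodule.span ℚ C).mkQ ∘ ((x ∘ a) ∘ e.symm)) := by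
    have : (Submodule.span ℚ C).mkQ ∘ ((x ∘ a) ∘ e.symm) =
        (((Submodule.span ℚ C).mkQ ∘ x) ∘ a) ∘ e.symm := rfl
    rw [this]
    exact (linearIndependent_equiv e.symm).mpr hli
  have hdim : relLinDim C x = Fintype.card κ := by
    unfold relLinDim
    rw [← hspan]
    exact finrank_span_eq_card hli
  rw [hdim]
  exact (le_relTrdeg_of_dcl_subset hAx hC hli').trans (relTrdeg_comp_le C x e a)

variable (K) in
/-- **Kirby 2010, Thm. 1.2** in the form `δ(x̄/C) ≥ 0` for `ecl`-closed `C` — the named fact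
`Kirby2010_weakSchanuel K` of `EclPregeometry.lean` — from Ax's theorem (`ax_schanuel`) and
Kirby's Prop. 7.1 (`Kirby2010_dcl_subset_ecl K`), as in the printed proof ("theorem 1.2
follows from corollary 5.2", p. 11). [cite: Kirby2010, Thm. 1.2] -/
theorem Kirby2010_weakSchanuel_of (hAx : Transcendental.ax_schanuel)
    (h71 : Kirby2010_dcl_subset_ecl K) : Kirby2010_weakSchanuel K :=
  fun _ hC _ x => relLinDim_le_relTrdeg_of_dcl_subset hAx (h71.dcl_subset_of_isEclClosed hC) x

end Cor52

end Literature.NumberTheory.Transcendental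

/-! ### The target fact -/

namespace Literature.NumberTheory.Transcendental

/-- **Kirby's weak Schanuel property over `ecl(∅)` for `ℂ_exp`** (the named fact
`kirby_weakSchanuel_ecl_empty`, Kirby 2010 Thm. 1.2 at `F = ℂ_exp`, `C = ecl ∅`), from the two
named facts it rests on in print: Ax's theorem (`Literature.NumberTheory.Transcendental.ax_schanuel`, Ax 1971
Thm. 3 = Kirby 2010 Thm. 5.1) and Kirby's Prop. 7.1 `cl ⊆ ecl` (`Literature.Kirby2010_dcl_subset_ecl ℂ`).
The `ecl`-closedness of `ecl ∅` (Kirby Thm. 1.1) is itself derived from Prop. 7.1 and the proved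
Prop. 4.7. [cite: Kirby2010, Thm. 1.2] -/
theorem kirby_weakSchanuel_ecl_empty_of (hAx : Transcendental.ax_schanuel)
    (h71 : Kirby2010_dcl_subset_ecl ℂ) : kirby_weakSchanuel_ecl_empty := by
  intro n x hx
  exact le_relTrdeg_of_dcl_subset hAx (h71.dcl_subset_of_isEclClosed (h71.ecl_idem ∅)) hx

end Literature.NumberTheory.Transcendental

namespace Literature.NumberTheory.Transcendental

/-- The fact `Literature.NumberTheory.Transcendental.kirby_relative_schanuel_complex` (`KirbyRelativeSchanuel.lean`) is verbatim the
same statement as `Periods.kirby_weakSchanuel_ecl_empty`; hence it too follows from Ax's theorem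
and Kirby's Prop. 7.1. [cite: Kirby2010, Thm. 1.2] -/
theorem kirby_relative_schanuel_complex_of (hAx : Transcendental.ax_schanuel)
    (h71 : Kirby2010_dcl_subset_ecl ℂ) : kirby_relative_schanuel_complex :=
  Transcendental.kirby_weakSchanuel_ecl_empty_of hAx h71

end Literature.NumberTheory.Transcendental
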